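import Summits.BirchSwinnertonDyer.Rank1Residual.Supersingular.X8PrintDischargeOnePrime
import Literature.NumberTheory.IwasawaTheory.CyclotomicRatTotallyRamified
import Literature.NumberTheory.GaloisRepresentations.PadicAlgebraIntegral
import HarnessLib

/-!
# Cell bsd-print-x8 (D-0131 (2) PRINT TIER), seat ty2 — DISCHARGE INTERFACE §8: on the small-image
# sub-leaf X8 ∩ {¬ surj(3)} the cyclotomic `ℤ₃`-extension of `L = ℚ(E[3])` is TOTALLY RAMIFIED at the
# prime above `3` from layer `0` (Fukuda's index `n₀ = 0`) — the `hram` binder of p2 g3's Fukuda doors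

HONEST FRAMING (cell `bsd-print-x8`, `run/shared/lean/pub/bsd-print-x8/`): seat ty2 = «leaf predicate
⟹ the cited theorem's hypotheses, sorry-free (Summits side), so provers close by name».  THEOREMS ONLY
(no definition, no named fact, nothing asserted about BSD).  Sequel of `X8PrintDischargeOnePrime` (§7:
`#Gal(ℚ(E[3])/ℚ) = 16`, one prime above `3`).

WHAT IS DISCHARGED.  Prover p2 g3's per-pair and class-wide «Fukuda doors» to statement (A) of
Coates–Sujatha on the road (γ) to crux 20622 (`Theorems/PrintX8SmallImageMuBoundCertificates.lean`,
p557381: `X8.conjA_of_classGroupPRank_one_eq`, `X8.conjA_of_classNumberPExp_one_eq`, and the class form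
with binder
`hram : ∀ W, ClassX8 W 3 → ¬ Surj W 3 → ∀ κL : ZpExtension (W.divisionField 3) 3, κL.IsCyclotomic →
TotallyRamifiedFrom κL 0`; TURNKEY to ty2, INBOX 2026-08-27T18:46:57Z) display the STRUCTURAL binder
`hram`: «the cyclotomic `ℤ₃`-tower of `L = ℚ(W[3])` is unramified outside `3` and totally ramified at the
(unique) prime above `3` from layer `0`» (Fukuda 1994's standing index `n₀ = 0`, tree definition
`IwasawaTheory.TotallyRamifiedFrom κL 0`).  It is proved here, binder-free from `ClassX8 W p ∧ ¬ Surj W p`: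

* §8a (general, `ℤ_p`-units) `exists_units_pow_pow_eq_pow` — for `u ∈ ℤ_pˣ` and `p ∤ d` there is
  `w ∈ ℤ_pˣ` with `(w^d)^{p−1} = u^{p−1}` (principal units are `m`-th powers for `p ∤ m`, tree theorems
  `LocalField.PadicInt.exists_pow_eq_of_norm_sub_one_lt` = Hensel and
  `LocalField.PadicInt.norm_unit_pow_sub_one_sub_one_lt` = `u^{p−1} ≡ 1 (mod p)`), i.e. `w^d ≡ u` modulo
  the torsion of `ℤ_pˣ`.
* §8b (general number field `K`, Galois over `ℚ`, `p ∤ [K : ℚ]`)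
  `inertia_sup_kerSubgroup_eq_top_of_isGalois_of_not_dvd_finrank` — **`I_𝔔 · Gal(K̄/K_∞) = Γ_K`** for the
  cyclotomic `ℤ_p`-extension `κ` of `K` (`ker κ = χ_p⁻¹(μ(ℤ_p))`) and every prime `𝔔` of `\bar ℤ_K` above a
  place `w ∣ p`: given `σ ∈ Γ_K`, take `w₁` as in §8a for `u = χ_p(σ)` and `d = [K : ℚ]`, `τ₀ ∈ I_𝔓`
  (`𝔓 = 𝔔 ∩ \bar ℤ`, a prime of `\bar ℤ` above `p`) with `χ_p(τ₀) = w₁` (`ℚ(μ_{p^∞})/ℚ` totally ramified at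
  `p`: tree theorem `exists_mem_inertia_cyclotomicCharacter_eq`); since `res(Γ_K) ⊴ Γ_ℚ` has index
  `[K : ℚ] = d` (`normal_range_absGaloisRestrict`, `index_range_absGaloisRestrict_eq_finrank`),
  `τ₀^d = res τ` with `τ ∈ res⁻¹(I_𝔓) = I_𝔔` (`comap_inertia_comap_absIntegersMap`), and
  `χ_p(τ⁻¹σ) = w₁^{−d} u` has `(p−1)`-th power `1`, so `τ⁻¹σ ∈ ker κ`.  Hence
  `totallyRamifiedFrom_zero_of_isCyclotomic_of_isGalois_of_not_dvd_finrank` (with the tree's «unramified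
  outside `p`», `ZpExtension.inertia_le_kerSubgroup_holds`, Washington Prop. 13.2).
* §8c AT THE LEAF: `ClassX8.totallyRamifiedFrom_zero_divisionField_of_not_surj` (per pair, the `hram`
  binder of `X8.conjA_of_classGroupPRank_one_eq` / `…_classNumberPExp_one_eq` verbatim) and
  `ClassX8.hram_three` (the class-wide binder of p557381's class form verbatim): `[ℚ(E[3]) : ℚ] = 16`
  (`ClassX8.not_dvd_card_aut_divisionField_of_not_surj`, §7) and `3 ∤ 16`.

NOT CLAIMED: the 156 surjective cells (`[ℚ(E[3]) : ℚ] = 48`; there the statement is still true — the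
inertia image has order `8` — but the index argument of §8b needs `p ∤ e(𝔔 ∣ p)` in place of
`p ∤ [K : ℚ]`, not typed here); anything about class numbers (the Fukuda doors' DATA binders `hrk`/`hord`
stay per-cell certificates).  Table of record: HOME/TY2-DISCHARGE-TABLE.md §L.  cells: 0.  beyond-print
theorem: no (Washington §13.1–13.2 bookkeeping; Neukirch II (7.13)).

## References

* [Washington1997] L. Washington, *Introduction to Cyclotomic Fields*, §13.1 (the cyclotomic
  `ℤ_p`-extension, total ramification of `ℚ_∞/ℚ` at `p`), Prop. 13.2 (unramified outside `p`).
* [Fukuda1994] T. Fukuda, Proc. Japan Acad. 70 A (1994), p. 264 (the index `n₀`).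
* [NeukirchANT1999] J. Neukirch, *Algebraic Number Theory*, Ch. II (4.9) (`m`-th roots of principal
  units), Ch. II (7.13)(i) (`ℚ_p(μ_{p^∞})` totally ramified), Ch. I §9 (inertia groups under restriction).
-/

noncomputable section

open scoped NumberField Pointwise
open Field IsDedekindDomain NumberField WeierstrassCurve Rat.HeightOneSpectrum
  Literature.NumberTheory.EllipticCurves Literature.NumberTheory.GaloisRepresentations
  Literature.NumberTheory.EllipticCurves.Rank1Residual
  Literature.NumberTheory.IwasawaTheory Literature.NumberTheory.GaloisRepresentations.LocalField

namespace Summit.BirchSwinnertonDyer.Rank1Residual.Supersingular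

/-! ### §8a. `ℤ_pˣ`: `d`-th roots modulo torsion for `p ∤ d` -/

section Units

variable {p : ℕ} [Fact p.Prime]

/-- For `u ∈ ℤ_pˣ` and `p ∤ d` there is `w ∈ ℤ_pˣ` with `(w^d)^{p−1} = u^{p−1}` (so `w^d u⁻¹` is torsion):
principal units are `m`-th powers for `p ∤ m` (Hensel, tree theorem
`LocalField.PadicInt.exists_pow_eq_of_norm_sub_one_lt`), applied with `m = d(p−1)` to `u^{p−1}`
(`LocalField.PadicInt.norm_unit_pow_sub_one_sub_one_lt`: `u^{p−1} ≡ 1 (mod p)`). -/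
theorem exists_units_pow_pow_eq_pow {d : ℕ} (hd : ¬ p ∣ d) (u : ℤ_[p]ˣ) :
    ∃ w : ℤ_[p]ˣ, (w ^ d) ^ (p - 1) = u ^ (p - 1) := by
  have hp : p.Prime := Fact.out
  have hp1 : ¬ p ∣ p - 1 := fun h ↦
    Nat.not_dvd_of_pos_of_lt (Nat.sub_pos_of_lt hp.one_lt) (Nat.sub_lt hp.pos one_pos) h
  have hm : ¬ p ∣ d * (p - 1) := fun h ↦ (hp.dvd_mul.mp h).elim hd hp1
  have hm0 : d * (p - 1) ≠ 0 := fun h0 ↦ hm (h0 ▸ dvd_zero p)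
  obtain ⟨y, hy⟩ := PadicInt.exists_pow_eq_of_norm_sub_one_lt
    ((Nat.Prime.coprime_iff_not_dvd hp).mpr hm) (PadicInt.norm_unit_pow_sub_one_sub_one_lt u)
  have hyu : IsUnit y := by
    refine (isUnit_pow_iff hm0).mp ?_
    rw [hy, ← Units.val_pow_eq_pow_val]
    exact Units.isUnit _
  refine ⟨hyu.unit, Units.ext ?_⟩
  rw [Units.val_pow_eq_pow_val, Units.val_pow_eq_pow_val, Units.val_pow_eq_pow_val, IsUnit.unit_spec,
    ← pow_mul, hy]

end Units

/-! ### §8b. A Galois number field of degree prime to `p`: its cyclotomic `ℤ_p`-extension is totally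
ramified above `p` from layer `0` -/

section General

variable {p : ℕ} [Fact p.Prime] (K : Type*) [Field K] [NumberField K] [IsGalois ℚ K]

/-- **`I_𝔔 ⊔ Gal(K̄/K_∞) = Γ_K`** for the cyclotomic `ℤ_p`-extension of a number field `K` Galois over `ℚ`
with `p ∤ [K : ℚ]`, at every prime `𝔔` of `\bar ℤ_K` above a place `w ∣ p` (the proof in the module
docstring, §8b).  For `K = ℚ` this is the tree's
`ZpExtension.IsCyclotomic.inertia_sup_kerSubgroup_eq_top`. -/
theorem inertia_sup_kerSubgroup_eq_top_of_isGalois_of_not_dvd_finrank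
    (hpK : ¬ p ∣ Module.finrank ℚ K) {κ : ZpExtension K p} (hκ : κ.IsCyclotomic)
    {w : HeightOneSpectrum (𝓞 K)} (hw : ((p : ℕ) : 𝓞 K) ∈ w.asIdeal)
    {𝔔 : Ideal (absIntegers (𝓞 K) K)} (h𝔔 : 𝔔 ∈ w.primesAbove) :
    𝔔.inertia (absoluteGaloisGroup K) ⊔ κ.kerSubgroup = ⊤ := by
  have hp : p.Prime := Fact.out
  haveI : NeZero p := ⟨hp.ne_zero⟩
  -- the place `v = (p)` of `ℚ` below `w`
  haveI : w.asIdeal.IsPrime := w.isPrime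
  haveI : (w.asIdeal.under (𝓞 ℚ)).IsPrime := Ideal.IsPrime.under (𝓞 ℚ) w.asIdeal
  have hmem : ((p : ℕ) : 𝓞 ℚ) ∈ w.asIdeal.under (𝓞 ℚ) := by
    rw [Ideal.under_def, Ideal.mem_comap, map_natCast]
    exact hw
  have hne : w.asIdeal.under (𝓞 ℚ) ≠ ⊥ := fun h ↦ by
    rw [h, Ideal.mem_bot] at hmem
    exact hp.ne_zero (by exact_mod_cast hmem)
  set v : HeightOneSpectrum (𝓞 ℚ) := ⟨w.asIdeal.under (𝓞 ℚ), inferInstance, hne⟩ with hvdef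
  have hv : (primesEquiv v : ℕ) = p := by
    rw [(natCast_mem_asIdeal_iff_eq_primesEquiv_symm v hp).mp hmem, Equiv.apply_symm_apply]
  have hwv : w.asIdeal.under (𝓞 ℚ) = v.asIdeal := rfl
  -- the prime `𝔓 = 𝔔 ∩ \bar ℤ` of `\bar ℤ` above `p`, and `res⁻¹(I_𝔓) = I_𝔔`
  have h𝔓 : 𝔔.comap (absIntegersMap ℚ K) ∈ v.primesAbove := comap_absIntegersMap_mem_primesAbove hwv h𝔔
  have hI : ∀ τ : absoluteGaloisGroup K,
      absGaloisRestrict ℚ K τ ∈ (𝔔.comap (absIntegersMap ℚ K)).inertia (absoluteGaloisGroup ℚ) →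
        τ ∈ 𝔔.inertia (absoluteGaloisGroup K) := by
    intro τ hτ
    rw [← comap_inertia_comap_absIntegersMap ℚ K 𝔔, Subgroup.mem_comap]
    exact hτ
  -- `res(Γ_K) ⊴ Γ_ℚ` of index `[K : ℚ]`, prime to `p`
  haveI hnormal : ((absGaloisRestrict ℚ K).range).Normal := normal_range_absGaloisRestrict ℚ K
  have hd : ¬ p ∣ (absGaloisRestrict ℚ K).range.index := by
    rw [index_range_absGaloisRestrict_eq_finrank ℚ K]
    exact hpK
  rw [eq_top_iff]
  intro σ _
  -- `w₁^d ≡ χ(σ)` modulo torsion, `τ₀ ∈ I_𝔓` with `χ(τ₀) = w₁`, `τ = res⁻¹(τ₀^d) ∈ I_𝔔`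
  obtain ⟨w₁, hw₁⟩ := exists_units_pow_pow_eq_pow hd (GaloisRep.cyclotomicCharacter K p σ)
  obtain ⟨τ₀, hτ₀I, hτ₀χ⟩ := exists_mem_inertia_cyclotomicCharacter_eq p hv h𝔓 w₁
  obtain ⟨τ, hτ'⟩ : τ₀ ^ (absGaloisRestrict ℚ K).range.index ∈ (absGaloisRestrict ℚ K).range :=
    Subgroup.pow_index_mem _ τ₀
  have hτ : absGaloisRestrict ℚ K τ = τ₀ ^ (absGaloisRestrict ℚ K).range.index := hτ'
  have hτI : τ ∈ 𝔔.inertia (absoluteGaloisGroup K) :=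
    hI τ (by rw [hτ]; exact Subgroup.pow_mem _ hτ₀I _)
  have hχτ : GaloisRep.cyclotomicCharacter K p τ = w₁ ^ (absGaloisRestrict ℚ K).range.index := by
    rw [← cyclotomicCharacter_absGaloisRestrict ℚ K p τ, hτ, map_pow, hτ₀χ]
  have hk : τ⁻¹ * σ ∈ κ.kerSubgroup := by
    rw [show κ.kerSubgroup = _ from hκ, Subgroup.mem_comap, CommGroup.mem_torsion]
    change IsOfFinOrder (GaloisRep.cyclotomicCharacter K p (τ⁻¹ * σ))
    rw [map_mul, map_inv, hχτ, isOfFinOrder_iff_pow_eq_one]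
    refine ⟨p - 1, Nat.sub_pos_of_lt hp.one_lt, ?_⟩
    rw [mul_pow, inv_pow, hw₁, inv_mul_cancel]
  rw [show σ = τ * (τ⁻¹ * σ) by rw [mul_inv_cancel_left]]
  exact Subgroup.mul_mem _ (Subgroup.mem_sup_left hτI) (Subgroup.mem_sup_right hk)

/-- **Fukuda's index is `n₀ = 0`** for the cyclotomic `ℤ_p`-extension of a number field `K` Galois over
`ℚ` with `p ∤ [K : ℚ]`: every prime of `\bar ℤ_K` above a finite place `w` is unramified in `K_∞/K`
(`w ∤ p`: `I_𝔔 ≤ ker κ`, the tree's `ZpExtension.inertia_le_kerSubgroup_holds`, Washington Prop. 13.2)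
or totally ramified from layer `0` (`w ∣ p`: `I_𝔔 ⊔ ker κ = Γ_K`,
`inertia_sup_kerSubgroup_eq_top_of_isGalois_of_not_dvd_finrank`).  For `K = ℚ` this is the tree's
`IwasawaTheory.totallyRamifiedFrom_zero_of_isCyclotomic_rat`. -/
theorem totallyRamifiedFrom_zero_of_isCyclotomic_of_isGalois_of_not_dvd_finrank
    (hpK : ¬ p ∣ Module.finrank ℚ K) {κ : ZpExtension K p} (hκ : κ.IsCyclotomic) :
    TotallyRamifiedFrom κ 0 := by
  rw [totallyRamifiedFrom_zero_iff]
  intro w 𝔔 h𝔔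
  by_cases hw : ((p : ℕ) : 𝓞 K) ∈ w.asIdeal
  · exact Or.inr (inertia_sup_kerSubgroup_eq_top_of_isGalois_of_not_dvd_finrank K hpK hκ hw h𝔔)
  · exact Or.inl (ZpExtension.inertia_le_kerSubgroup_holds K p κ hw h𝔔)

/-- … hence `TotallyRamifiedFrom κ n₀` for EVERY index `n₀` (`TotallyRamifiedFrom.mono`). -/
theorem totallyRamifiedFrom_of_isCyclotomic_of_isGalois_of_not_dvd_finrank
    (hpK : ¬ p ∣ Module.finrank ℚ K) {κ : ZpExtension K p} (hκ : κ.IsCyclotomic) (n₀ : ℕ) :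
    TotallyRamifiedFrom κ n₀ :=
  (totallyRamifiedFrom_zero_of_isCyclotomic_of_isGalois_of_not_dvd_finrank K hpK hκ).mono (Nat.zero_le n₀)

end General

/-! ### §8c. At the leaf X8 ∩ {¬ surj(3)}: the `hram` binder of the Fukuda doors -/

section Leaf

variable (W : WeierstrassCurve ℚ) [W.IsElliptic] [W.IsGloballyMinimal] (p : ℕ) [Fact p.Prime]

/-- **X8 ∧ `ρ̄_{E,3}` not onto ⟹ the cyclotomic `ℤ₃`-extension of `ℚ(E[3])` is totally ramified above `3`
from layer `0`** — the `hram` binder of p2 g3's per-pair Fukuda doors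
`X8.conjA_of_classGroupPRank_one_eq` / `X8.conjA_of_classNumberPExp_one_eq`
(`Theorems/PrintX8SmallImageMuBoundCertificates.lean`), VERBATIM: `ℚ(E[3])/ℚ` is Galois of degree
`#C_ns⁺(3) = 16` (`ClassX8.not_dvd_card_aut_divisionField_of_not_surj`, §7) and `3 ∤ 16`. -/
theorem ClassX8.totallyRamifiedFrom_zero_divisionField_of_not_surj (hX : ClassX8 W p) (hns : ¬ Surj W p) :
    haveI : NeZero p := ⟨(Fact.out : p.Prime).ne_zero⟩
    ∀ κL : ZpExtension (W.divisionField p) p, κL.IsCyclotomic → TotallyRamifiedFrom κL 0 := by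
  haveI : NeZero p := ⟨(Fact.out : p.Prime).ne_zero⟩
  haveI : FiniteDimensional ℚ (W.divisionField p) := W.finiteDimensional_divisionField p
  haveI : IsGalois ℚ (W.divisionField p) := W.isGalois_divisionField p
  haveI : NumberField (W.divisionField p) := NumberField.mk
  intro κL hκL
  refine totallyRamifiedFrom_zero_of_isCyclotomic_of_isGalois_of_not_dvd_finrank (W.divisionField p) ?_ hκL
  rw [← IsGalois.card_aut_eq_finrank]
  exact ClassX8.not_dvd_card_aut_divisionField_of_not_surj W p hX hns

/-- The same for every Fukuda index `n₀`. -/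
theorem ClassX8.totallyRamifiedFrom_divisionField_of_not_surj (hX : ClassX8 W p) (hns : ¬ Surj W p)
    (n₀ : ℕ) :
    haveI : NeZero p := ⟨(Fact.out : p.Prime).ne_zero⟩
    ∀ κL : ZpExtension (W.divisionField p) p, κL.IsCyclotomic → TotallyRamifiedFrom κL n₀ := by
  intro κL hκL
  exact (ClassX8.totallyRamifiedFrom_zero_divisionField_of_not_surj W p hX hns κL hκL).mono
    (Nat.zero_le n₀)

/-- **The class-wide `hram` binder of p557381's class form, VERBATIM** (`p = 3` literal): on every X8 pair
with `ρ̄_{E,3}` not onto, the cyclotomic `ℤ₃`-extension of `ℚ(E[3])` has Fukuda index `n₀ = 0`. -/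
theorem ClassX8.hram_three :
    ∀ (W : WeierstrassCurve ℚ) [W.IsElliptic] [W.IsGloballyMinimal],
      ClassX8 W 3 → ¬ Surj W 3 →
        ∀ κL : ZpExtension (W.divisionField 3) 3, κL.IsCyclotomic → TotallyRamifiedFrom κL 0 :=
  fun W _ _ hX hns ↦ ClassX8.totallyRamifiedFrom_zero_divisionField_of_not_surj W 3 hX hns

end Leaf

end Summit.BirchSwinnertonDyer.Rank1Residual.Supersingular

end
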